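import Summits.QuantumAdvantage.QuantumAdvantage.Theorems.CubicForrelationNearExactIsExactTwelveTypeOWindow
import Summits.QuantumAdvantage.QuantumAdvantage.Theorems.CubicForrelationNearExactIsExactTwelveLevelSixWindow
import Summits.QuantumAdvantage.QuantumAdvantage.Theorems.CubicForrelationNearExactIsExactTwelveLevelFiveWindow

/-!
# Crux `CubicForrelation.NearExactIsExact` (stmt-QuantumAdvantage-14043) — n = 12: `Φ ≥ 955/1024 ⇒ Φ = 1`, i.e. `θ₁₂ < 955/1024`
  (the first exclusions strictly below the second dyadic boundary `15/16 = 960/1024`)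

Certificate seat `b2b-cforr-cert` (gen 13).  HONEST FRAMING: a kernel-checked, two-sided, DECIDABLE VERDICT about the finite slice `n = 12` of the
crux (cubic Boolean pairs on 12 bits) — NOT summit progress.  The crux asks for one `θ < 1` isolating exactness on EVERY even number of bits;
this file only shrinks the undecided window at `n = 12` from `[57/64, 15/16) = [912, 960)/1024` (`theta_twelve_halfopen`) to
`[912, 955)/1024`: the five values `955/1024, …, 959/1024` are NOT Forrelation values of cubic pairs on 12 bits.

THEOREMS: `isolation_twelve_955` (∀ cubic `f g : (Fin 12 → Bool) → Bool`, `955/1024 ≤ Φ(f,g) ⇒ Φ(f,g) = 1`), `theta_twelve_lt_955`,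
`theta_twelve_halfopen_955` (`θ₁₂ ∈ [57/64, 955/1024)`), `no_window_twelve_955`.

Assembly (`tw_isolation_955`): `Φ ≥ 955/1024 > 59/64` forces both Walsh spectra into `32ℤ` (`to12_window_typeE`, gen 12: a type-O side has
`Φ ≤ 59/64`); if some `W_g/32` is odd (level 5) use `tw5_levelFive_window` (needs the partner's spectrum in `32ℤ`); otherwise `W_g ∈ 64ℤ`
(level `≥ 6`) and `tw6_levelSix_window` applies (its one exceptional value `954/1024` lies below `955/1024`).  Method in one line: below the
boundary the residual `u − 4(−1)^f` is no longer supported on an exact flat, but its WILD part is so sparse (`≤ 7` points) that Reed–Muller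
distances on the abstract 9- or 11-flat (`erm_weight_ge`), a Pfaffian parity for 4-flat sign sums (`ws_sum4_mod8`) and — at level 5 — one
Walsh inversion against the type-E partner force it to vanish.

WHAT IS OPEN at `n = 12` after this file: `θ₁₂ ∈ [912/1024, 955/1024)`; the next value `954/1024` has explicit residual configurations
surviving every step here (level 6: one wild point of height `|e| = 7` on the 9-flat; level 5: a wild 2-flat), so it needs a new input.

References: J. Ax (1964) / R. J. McEliece (1972); X.-D. Hou (1998); T. Kasami, N. Tokura (1970); MacWilliams–Sloane (1977) Ch. 13–15;
C. Carlet (2021); R. O'Donnell (2014) §3.3.  Everything below is proved from Mathlib and the tree; axioms are the standard three.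
-/

set_option linter.dupNamespace false -- D-0017: single-problem summit ⇒ `QuantumAdvantage.QuantumAdvantage` by design

noncomputable section

namespace Summit.QuantumAdvantage.QuantumAdvantage.Theorems.CubicForrelation.NearExactIsExact

open Finset
open Literature.Computability.QuantumComplexity
open Literature.Computability.QuantumComplexity.DerivativeWalsh (W)

/-! ### Assembly: `Φ ≥ 955/1024 ⇒ Φ = 1` on 12 bits -/

/-- **`Φ ≥ 955/1024 ⇒ Φ = 1` for cubic pairs on `6 + 6` bits.**  Type O is excluded above `59/64` (`to12_window_typeE`), so both spectra
lie in `32ℤ`; a level-5 side is handled by `tw5_levelFive_window`, a level-`≥ 6` side by `tw6_levelSix_window` (its exceptional value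
`477/512 = 954/1024` lies below `955/1024`).  NOT summit progress. [this work] -/
theorem tw_isolation_955 (f g : (Fin (6 + 6) → Bool) → Bool) (hf : IsDegLeFun 3 f) (hg : IsDegLeFun 3 g)
    (hΦ : (955 / 1024 : ℝ) ≤ forrelation f g) : forrelation f g = 1 := by
  have hlo : (59 / 64 : ℝ) < forrelation f g := by linarith
  obtain ⟨hgE, hfE⟩ := to12_window_typeE f g hf hg hlo
  choose u' hu' using hgE
  have hu'5 : ∀ x, W (fun y => signOf (g y)) x = (2 : ℝ) ^ 5 * (u' x : ℝ) := fun x => (hu' x).trans (by norm_num)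
  by_cases hodd : ∃ x, Odd (u' x)
  · exact tw5_levelFive_window f g hf hg u' hu'5 hodd hfE hΦ
  · push Not at hodd
    have hu6 := tw_level_up g u' hu'5 hodd
    exact tw6_levelSix_window f g hf hg (fun x => u' x / 2) (fun x => (hu6 x).trans (by norm_num)) (by linarith)
      (by intro h; rw [h] at hΦ; norm_num at hΦ)

/-- **On 12 bits, `Φ ≥ 955/1024 ⇒ Φ = 1`** for all cubic `f, g : 𝔽₂¹² → 𝔽₂` (at the literal type `Fin 12`).  The tree had `15/16 = 960/1024`
(`isolation_twelve_closed`); the five values `955/1024, …, 959/1024` are new exclusions.  A kernel-checked, two-sided, decidable verdict about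
the finite slice `n = 12`; NOT summit progress. [this work] -/
theorem isolation_twelve_955 : ∀ f g : (Fin 12 → Bool) → Bool, IsDegLeFun 3 f → IsDegLeFun 3 g →
    (955 / 1024 : ℝ) ≤ forrelation f g → forrelation f g = 1 :=
  fun f g hf hg h => tw_isolation_955 f g hf hg h

/-- **`θ₁₂ < 955/1024`.** NOT summit progress. [this work] -/
theorem theta_twelve_lt_955 : ∃ θ : ℝ, θ < 955 / 1024 ∧ ∀ f g : (Fin 12 → Bool) → Bool, IsDegLeFun 3 f → IsDegLeFun 3 g →
    θ < forrelation f g → forrelation f g = 1 :=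
  fb_theta_lt_of_closed (n := 12) _ isolation_twelve_955

/-- **`θ₁₂ ∈ [57/64, 955/1024)`** (the tree had `[57/64, 15/16)`, `theta_twelve_halfopen`). NOT summit progress. [this work] -/
theorem theta_twelve_halfopen_955 : ∃ θ₀ : ℝ, 57 / 64 ≤ θ₀ ∧ θ₀ < 955 / 1024 ∧
    IsLeast {θ : ℝ | ∀ f g : (Fin 12 → Bool) → Bool, IsDegLeFun 3 f → IsDegLeFun 3 g →
      θ < forrelation f g → forrelation f g = 1} θ₀ := by
  obtain ⟨θ₀, hθ₀⟩ := theta_exists 12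
  obtain ⟨θ', hθ', hiso⟩ := theta_twelve_lt_955
  exact ⟨θ₀, theta_twelve_bounds.2 θ₀ hθ₀.1, lt_of_le_of_lt (hθ₀.2 hiso) hθ', hθ₀⟩

/-- **No cubic pair on 12 bits has `Φ ∈ [955/1024, 1)`** — in particular none of the values `955/1024, …, 959/1024`. NOT summit progress.
[this work] -/
theorem no_window_twelve_955 : ¬ ∃ f g : (Fin 12 → Bool) → Bool, IsDegLeFun 3 f ∧ IsDegLeFun 3 g ∧
    (955 / 1024 : ℝ) ≤ forrelation f g ∧ forrelation f g < 1 := by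
  rintro ⟨f, g, hf, hg, hlo, hlt⟩
  have h := isolation_twelve_955 f g hf hg hlo
  linarith

end Summit.QuantumAdvantage.QuantumAdvantage.Theorems.CubicForrelation.NearExactIsExact

end
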